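/-
Copyright (c) 2026 the pub-hodgecm-mathlib formalisation cell (harness21).  Prover seat hodgecm-mathlib-LH4-p05 (g0): unit U2H_HSide of the «(D-RAM) FOUR-FRAME» road,
TIER-2 file paying the stub `stub_U2H_hFamily_smooth` of `Cruxes/H413/Lines/F0_P3c_DyRamFourFrame_U2H_HSide.lean` (ED. 2, §1b) BY NAME (heir LEAD F0P3a-plan (g19)
«FOUR-FRAME SKELETON LANDED» EMIT LIST #2; dealer LH4-plan (g10)).  2026-09-03.
-/
import Summits.HodgeConjecture.HodgeConjecture.Theorems.F0P3cDyRamFourFrameHFamilyDefs   -- DEFS LEAF №5 (LH4-p03): `hFamily = ![hProfileZero, hProfileSharp]`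
import Literature.NumberTheory.Rogawski1990.LocalTransferFundamentalLemma               -- ★ `IsLocSmooth`, `isLocSmooth_indicator_subgroup`
import Literature.NumberTheory.Rogawski1990.RankOneKappaVertexCoverWild                 -- ★ `exists_vertexCover_of_ramified_wild` (`K♯` compact open at ANY ramified place)
import Literature.NumberTheory.Rogawski1990.DepthZeroTransferHValuesTypeOneRamified     -- ★ `diagonal_inv_mul_mul_diagonal_apply_eq` (the skeleton's `K♯` spelling)
import Literature.NumberTheory.Automorphic.UnitaryTwoRamifiedTreeStabilizers             -- ★ `coe_mem_map_conj_glDiagonal_iff_forall_v_le_one` (`K♯` by entries)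
import Literature.NumberTheory.Automorphic.UnitOrbitalIntegralFixedPointsPair             -- ★ `cmLocalIntegralLevel_one_eq_top_of_smul_eq` (`U₁ = U(Φ₁)(𝒪_v)`)
import Literature.NumberTheory.Automorphic.UnitaryResiduallyRegularOrbitalIntegral        -- ★ `isCompact_isOpen_cmLocalIntegralLevel_prod` (`K_H = K₂ × K₁`)
import Literature.NumberTheory.Automorphic.LocalUnitaryIntegralLevel                      -- ★ `isCompact_isOpen_cmLocalIntegralLevel`, `isUnit_placeForm_antidiagOne`
import HarnessLib

/-!
# Crux `H413`, line LH4 «(D-RAM) FOUR-FRAME» — unit U2H_HSide (ii-H), TIER 2: the explicit H-side family `hFamily` is smooth,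
# `IsLocSmooth (hFamily L w hw ϖ s)` (pays `F0P3cDyRamFourFrameU2H.stub_U2H_hFamily_smooth` BY NAME)

Cell `hodgecm-mathlib` (D-0151), FLOOR 0, crux item H413 = `stmt-HodgeConjecture-24833`, route of record `HCCMUnconditional`; squad F0∕P3c∕LH4; tier-1 module
`Cruxes/H413/Lines/F0_P3c_DyRamFourFrame_U2H_HSide.lean` ED. 2 (assembler LH4-p03 (g11), dealer LH4-plan (g10)), §1b stub `stub_U2H_hFamily_smooth` (desk row
`hFamily_smooth_compact`, size S).  THEOREMS ONLY (no `def`, no instance, no notation, no `sorry`, default heartbeats); lane `--supports stmt-HodgeConjecture-24833`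
(count-neutral).

WHAT IS PROVED.  `isLocSmooth_hFamily` — the statement of the stub TOKEN FOR TOKEN (binders `hw`, `_he`, `ϖ`, `_hϖ`, `s`): at a ramified non-split CM place `w ∣ v`
with a uniformiser `ϖ` of `L_w` (`|ϖ|_w = exp(−1)`), each profile of the explicit H-side family `hFamily L w hw ϖ = ![hProfileZero L v, hProfileSharp L w hw ϖ]`
(DEFS LEAF №5) on `H_v = U(Φ₂)(L⁺_v) × U(Φ₁)(L⁺_v)` is locally constant with compact support:
* `s = 0`: `hProfileZero = 1_{K_H}`, `K_H = K₂ × K₁` the product of the integral levels (★ `cmLocalIntegralLevel`), compact open (★ `isCompact_isOpen_cmLocalIntegralLevel_prod`)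
  ⇒ ★ `isLocSmooth_indicator_subgroup`;
* `s = 1`: `hProfileSharp = 1_S`, `S = {h | ∀ a b, |ϖ^b ϖ^{−a} (h_{2,w})_{ab}|_w ≤ 1}`; the set-builder IS the subgroup `K♯ × U₁`, `K♯ = e₂⁻¹(U ∩ D_ϖ GL₂(𝒪_w) D_ϖ⁻¹)`
  the compact open stabiliser of the `ϖ`-modular vertex supplied at ANY ramified place by ★ `exists_vertexCover_of_ramified_wild` (`η := ϖ` as a unit; no `|2|_w = 1`,
  no anti-fixed uniformiser), read through ★ `coe_mem_map_conj_glDiagonal_iff_forall_v_le_one` + ★ `diagonal_inv_mul_mul_diagonal_apply_eq` (the tame file's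
  dictionary, verbatim), and `U₁ = U(Φ₁)(L⁺_v) = U(Φ₁)(𝒪_v)` compact at a non-split place (★ `cmLocalIntegralLevel_one_eq_top_of_smul_eq`) ⇒ ★ `isLocSmooth_indicator_subgroup`.
The ramification binder `_he` is consumed only through ★ `exists_vertexCover_of_ramified_wild`; `_hϖ` only through `ϖ ≠ 0` and `|ϖ| = exp(−1)` (the unit `η`).

* §1 `isLocSmooth_hProfileZero`, `setOf_hProfileSharp_eq_prod`-shaped step inside `isLocSmooth_hProfileSharp`.
* §2 **`isLocSmooth_hFamily`** — `U2H_HSide.stub_U2H_hFamily_smooth` TOKEN FOR TOKEN.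

HONEST LABEL.  Count-neutral; the verdict of record for (D-RAM) stays PRINT [LanglandsShelstad1989 Thm. p. 484 ∕ Rogawski1990 Prop. 4.9.1 (a)] ∕ XL; `HC_CM` is proved only
modulo the 7 printed citations (2 remaining: hLiu418 = `stmt-HodgeConjecture-24832`, h413 = `stmt-HodgeConjecture-24833`) until rung 0 closes.

## References
* [Rogawski1990] J. D. Rogawski, *Automorphic Representations of Unitary Groups in Three Variables*, Ann. of Math. Stud. 123 (1990), §1.6 p. 6 (`C(G, ω)`), §4.9
  Prop. 4.9.1 (b) p. 55 and Lemma 4.9.3 p. 56 (the two vertex types of the ramified `U(1,1)`).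
* [Tits1979] J. Tits, *Reductive groups over local fields*, Proc. Sympos. Pure Math. 33.1 (1979), §3.2, §3.9 (maximal compact subgroups as vertex stabilisers).
* [Serre1980Trees] J.-P. Serre, *Trees* (1980), Ch. II §1.1, §1.3.
-/

noncomputable section

namespace Summit.HodgeConjecture.HodgeConjecture.Cruxes.H413.F0P3cDyRamHFamilySmooth

open MeasureTheory Measure NumberField IsDedekindDomain Topology Filter
open Literature.NumberTheory.Automorphic Literature.NumberTheory.Automorphic.UnitaryGroup Literature.NumberTheory.Automorphic.IntegralReduction
open Literature.NumberTheory.Rogawski1990 Literature.NumberTheory.GaloisRepresentations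
open Literature.NumberTheory.Automorphic.UnitaryThreeFourFrame
open Summit.HodgeConjecture.HodgeConjecture.Cruxes.H413.F0P3cDyRamFourFrameHSideDefs
open Summit.HodgeConjecture.HodgeConjecture.Cruxes.H413.F0P3cDyRamFourFrameHFamilyDefs
open scoped Matrix MatrixGroups Classical ValuativeRel

/-! ## §1  The two profiles -/

section Place

variable (L : Type) [Field L] [NumberField L] [IsCMField L] {v : HeightOneSpectrum (𝓞 ↥(maximalRealSubfield L))}
  (w : UnitaryGroup.PlacesOver L v) (hw : IsCMField.complexConj L • w.1 = w.1)

/-- **`1_{K_H} ∈ C_c^∞(H_v)`**: the indicator of the integral level `K_H = K₂ × K₁` (compact open, ★ `isCompact_isOpen_cmLocalIntegralLevel_prod`) is locally constant with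
compact support. [cite: Rogawski1990, §4.9 Prop. 4.9.1 (b) p. 55] -/
theorem isLocSmooth_hProfileZero (v : HeightOneSpectrum (𝓞 ↥(maximalRealSubfield L))) : IsLocSmooth (hProfileZero L v) :=
  isLocSmooth_indicator_subgroup _
    (isCompact_isOpen_cmLocalIntegralLevel_prod L 2 1 (Matrix.of fun i j : Fin 2 => if i.val + j.val + 1 = 2 then (1 : L) else 0)
      (Matrix.of fun i j : Fin 1 => if i.val + j.val + 1 = 1 then (1 : L) else 0) v).2
    (isCompact_isOpen_cmLocalIntegralLevel_prod L 2 1 (Matrix.of fun i j : Fin 2 => if i.val + j.val + 1 = 2 then (1 : L) else 0)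
      (Matrix.of fun i j : Fin 1 => if i.val + j.val + 1 = 1 then (1 : L) else 0) v).1

include hw in
/-- **`1_{K♯ × U₁} ∈ C_c^∞(H_v)` AT ANY RAMIFIED NON-SPLIT PLACE**: for a uniformiser `ϖ` of `L_w`, the set `{h | ∀ a b, |ϖ^b ϖ^{−a} (h_{2,w})_{ab}|_w ≤ 1}` of DEFS LEAF №5
is the compact open subgroup `K♯ × U(Φ₁)(L⁺_v)`, `K♯ = e₂⁻¹(U ∩ D_ϖ GL₂(𝒪_w) D_ϖ⁻¹)` the stabiliser of the `ϖ`-modular vertex (★ `exists_vertexCover_of_ramified_wild`, ★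
`coe_mem_map_conj_glDiagonal_iff_forall_v_le_one`, ★ `diagonal_inv_mul_mul_diagonal_apply_eq`), `U(Φ₁)(L⁺_v)` compact (★ `cmLocalIntegralLevel_one_eq_top_of_smul_eq`); so its
indicator is locally constant with compact support. [cite: Rogawski1990, §4.9 Lemma 4.9.3 p. 56] [cite: Tits1979, §3.2 and §3.9] [cite: Serre1980Trees, Ch. II §1.1] -/
theorem isLocSmooth_hProfileSharp (he : v.asIdeal.ramificationIdx' w.1.asIdeal ≠ 1) {ϖ : w.1.adicCompletion L}
    (hϖ : Valued.v ϖ = WithZero.exp (-1 : ℤ)) : IsLocSmooth (hProfileSharp L w hw ϖ) := by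
  -- the uniformiser as a unit
  have hϖ0 : ϖ ≠ 0 := by
    intro h0
    rw [h0, map_zero] at hϖ
    exact WithZero.coe_ne_zero hϖ.symm
  obtain ⟨ϖu, hϖu⟩ : ∃ ϖu : (w.1.adicCompletion L)ˣ, (ϖu : w.1.adicCompletion L) = ϖ := ⟨Units.mk0 ϖ hϖ0, rfl⟩
  have hϖ' : Valued.v (ϖu : w.1.adicCompletion L) = WithZero.exp (-1 : ℤ) := by rw [hϖu]; exact hϖ
  -- the `ϖ`-modular vertex stabiliser `K₂ 1 = K♯` at ANY ramified place (★ wild cover), compact open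
  obtain ⟨K₂, -, -, hd1', hK₂o, hK₂c, -⟩ := exists_vertexCover_of_ramified_wild L v w hw he ϖu hϖ'
  -- `U₁ = U(Φ₁)(L⁺_v)` is its own integral level, hence compact
  have hK1 : cmLocalIntegralLevel L 1 (Matrix.of fun i j : Fin 1 => if i.val + j.val + 1 = 1 then (1 : L) else 0) v = ⊤ :=
    cmLocalIntegralLevel_one_eq_top_of_smul_eq L _ w hw (isUnit_placeForm_antidiagOne (E := L) 1 w.1)
  have hopen : IsOpen (((K₂ 1).prod (⊤ : Subgroup ((cmDatum L 1 (Matrix.of fun i j : Fin 1 => if i.val + j.val + 1 = 1 then (1 : L) else 0)).Local v)) : Subgroup _) :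
      Set ((cmDatum L 2 (Matrix.of fun i j : Fin 2 => if i.val + j.val + 1 = 2 then (1 : L) else 0)).Local v ×
        (cmDatum L 1 (Matrix.of fun i j : Fin 1 => if i.val + j.val + 1 = 1 then (1 : L) else 0)).Local v)) := by
    rw [Subgroup.coe_prod, Subgroup.coe_top]; exact (hK₂o 1).prod isOpen_univ
  have hcpt : IsCompact (((K₂ 1).prod (⊤ : Subgroup ((cmDatum L 1 (Matrix.of fun i j : Fin 1 => if i.val + j.val + 1 = 1 then (1 : L) else 0)).Local v)) : Subgroup _) :
      Set ((cmDatum L 2 (Matrix.of fun i j : Fin 2 => if i.val + j.val + 1 = 2 then (1 : L) else 0)).Local v ×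
        (cmDatum L 1 (Matrix.of fun i j : Fin 1 => if i.val + j.val + 1 = 1 then (1 : L) else 0)).Local v)) := by
    have h1 := (isCompact_isOpen_cmLocalIntegralLevel L 1 (Matrix.of fun i j : Fin 1 => if i.val + j.val + 1 = 1 then (1 : L) else 0) v).1
    rw [hK1, Subgroup.coe_top] at h1
    rw [Subgroup.coe_prod, Subgroup.coe_top]; exact (hK₂c 1).prod h1
  -- the skeleton's set IS `K♯ × U₁` (★ `coe_mem_map_conj_glDiagonal_iff_forall_v_le_one`, the tame dictionary verbatim)
  have hset : {h : ((cmDatum L 2 (Matrix.of fun i j : Fin 2 => if i.val + j.val + 1 = 2 then (1 : L) else 0)).Local v ×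
        (cmDatum L 1 (Matrix.of fun i j : Fin 1 => if i.val + j.val + 1 = 1 then (1 : L) else 0)).Local v) |
      ∀ a b : Fin 2, Valued.v (ϖ ^ (b : ℕ) * (ϖ ^ (a : ℕ))⁻¹ *
        (((localNonsplitEquiv (IsCMField.complexConj L) (Matrix.of fun i j : Fin 2 => if i.val + j.val + 1 = 2 then (1 : L) else 0)
              (IsCMField.complexConj_ne_one L) w hw h.1 :
            ↥(unitaryGroupOfForm (galAdicCompletionMap (L := L) (IsCMField.complexConj L) hw)
                (placeForm (Matrix.of fun i j : Fin 2 => if i.val + j.val + 1 = 2 then (1 : L) else 0) w.1))) :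
            GL (Fin 2) (w.1.adicCompletion L)) : Matrix (Fin 2) (Fin 2) (w.1.adicCompletion L)) a b) ≤ 1} =
      (((K₂ 1).prod (⊤ : Subgroup ((cmDatum L 1 (Matrix.of fun i j : Fin 1 => if i.val + j.val + 1 = 1 then (1 : L) else 0)).Local v)) : Subgroup _) :
        Set ((cmDatum L 2 (Matrix.of fun i j : Fin 2 => if i.val + j.val + 1 = 2 then (1 : L) else 0)).Local v ×
          (cmDatum L 1 (Matrix.of fun i j : Fin 1 => if i.val + j.val + 1 = 1 then (1 : L) else 0)).Local v)) := by
    ext x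
    rw [Set.mem_setOf_eq, SetLike.mem_coe, Subgroup.mem_prod, hd1' x.1,
      coe_mem_map_conj_glDiagonal_iff_forall_v_le_one L w hw ϖu]
    simp only [diagonal_inv_mul_mul_diagonal_apply_eq, hϖu, Subgroup.mem_top, and_true]
  show IsLocSmooth (Set.indicator _ fun _ => (1 : ℂ))
  rw [hset]
  exact isLocSmooth_indicator_subgroup _ hopen hcpt

end Place

/-! ## §2  The stub, TOKEN FOR TOKEN -/

/-- **`U2H_HSide.stub_U2H_hFamily_smooth` PAID BY NAME** — each profile of the explicit H-side family `hFamily L w hw ϖ = ![1_{K_H}, 1_{K♯ × U₁}]` (DEFS LEAF №5) is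
locally constant with compact support (`IsLocSmooth`, the hypothesis shape `(_ : ∀ s, IsLocSmooth (ψ s))` of (D-H) `HSideAnchorRows` and of ★ `localTransferAtOne_of_populations`):
`s = 0` is §1 `isLocSmooth_hProfileZero` (no place hypothesis used), `s = 1` is §1 `isLocSmooth_hProfileSharp` (uses `hw`, the ramification binder and `|ϖ| = exp(−1)`).
Statement = the stub's, binders included. [cite: Rogawski1990, §4.9 Prop. 4.9.1 (b) p. 55 and Lemma 4.9.3 p. 56] -/
theorem isLocSmooth_hFamily (L : Type) [Field L] [NumberField L] [IsCMField L]
    {v : HeightOneSpectrum (𝓞 ↥(maximalRealSubfield L))} (w : PlacesOver L v)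
    (hw : IsCMField.complexConj L • w.1 = w.1) (_he : v.asIdeal.ramificationIdx' w.1.asIdeal ≠ 1)
    (ϖ : (w.1.adicCompletion L)) (_hϖ : Valued.v ϖ = WithZero.exp (-1 : ℤ)) (s : Fin 2) :
    IsLocSmooth (hFamily L w hw ϖ s) := by
  have h0 : IsLocSmooth (hProfileZero L v) := isLocSmooth_hProfileZero L v
  have h1 : IsLocSmooth (hProfileSharp L w hw ϖ) := isLocSmooth_hProfileSharp L w hw _he _hϖ
  fin_cases s
  exacts [h0, h1]

end Summit.HodgeConjecture.HodgeConjecture.Cruxes.H413.F0P3cDyRamHFamilySmooth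

end
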